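import Literature.NumberTheory.Transcendental.QuantitativeCIA
import Literature.NumberTheory.Transcendental.NesterenkoEliminationCor410Proofs
import Literature.NumberTheory.Transcendental.SchanuelEclEmptyProofs
import HarnessLib

/-!
# The quantitative criterion for the value of an integer polynomial (Ably 1994, §I "Critère") — proofs only

`Literature/NumberTheory/Transcendental/QuantitativeCIAPolynomial.lean` — proofs only (no
definitions, no named facts, nothing asserted). Second step towards the named fact
`Ably1994_lindemannWeierstrass_measure` (`LindemannWeierstrassMeasure.lean`): the AFFINE form of
the quantitative criterion for algebraic independence, i.e. Ably's "Critère" (Acta Arith. 67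
(1994), p. 31, from Jabbouri's criterion) — a lower bound for `|P(θ)|`, `P ∈ ℤ[X₁, …, X_m]`, from
families of small forms without common zero near `θ` at every scale — deduced from the criterion
for homogeneous primes `QuantCIA.quantitativeCIA` (`QuantitativeCIA.lean`, LNM 1752 Ch. 8 (CIA) in
Nesterenko's normalisation) the way Ably deduces his Critère from Jabbouri's (p. 31: "avec
`k = n − 1`, l'idéal `I` étant de dimension `n − 1`"): the hypersurface `P = 0` is cut out of the
cone ideal `𝔭_ω̄` of the point (`ω̄ = (1, θ)`, LNM 1752 Ch. 3 §5) by the homogenisation `ʰP`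
(Prop. 4.11 of Ch. 3, whose `δ` is `≤ ‖ʰP‖_ω̄ ≤ |P(θ)|` because `|𝔭_ω̄(ω̄)| = 0`, Cor. 4.10), a
prime component of the cut inherits a share of the smallness (Prop. 4.7 3) and the weighted
pigeonhole `PhilipponMain.exists_component_le_exp`), and the criterion bounds that component's
value from below.

Printed statement (Ably 1994, §I, p. 31): "Critère. Soient `K` un corps de nombres et
`θ = (θ₁, …, θₙ) ∈ ℂⁿ`. Soient `1 ≤ δ, τ, σ` et `U` des nombres réels positifs avec `σ ≥ 1` et
`U ≥ 2 max(τ, σⁿ)`. On suppose que pour tout entier `S` vérifiant (a) `τ/σⁿ < S ≤ U/σⁿ`, il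
existe une famille finie de polynômes `(Q_{S,j})_{j=1,…,m(S)} ⊂ K[X₁, …, Xₙ]` telle que :
(b) `max_j deg Q_{S,j} ≤ δ`; (c) `max_j h(Q_{S,j}) + δ(n+1) log(n+1) ≤ τ`;
(d) `max_j |Q_{S,j}(θ)|/|θ|^{deg Q_{S,j}} ≤ exp(−Sσⁿ)` où `|θ| = max(1, |θ₁|, …, |θₙ|)`;
(e) les polynômes `Q_{S,j}` sont sans zéros communs dans la boule de centre `θ` et de rayon
`exp(−Sσ^{n+1})` de `ℂⁿ`. Alors, pour tout polynôme `P` non nul de `ℤ[X₁, …, Xₙ]`, de hauteur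
logarithmique `h` et de degré `D`, satisfaisant
(f) `(4[K:ℚ]+n+1)(27σ)ⁿ (hδⁿ + (τn + δ(n+1)² log(n+1)) Dδ^{n−1}) ≤ U`, on a
`log |P(θ₁, …, θₙ)| ≥ −U − nD log 2(n+1) − n² log|θ| − 2n log(n+1)`."

What is proved (`QuantCIA.exists_const_polynomial_measure`): `K = ℚ`, forms with rational
coefficients, and the dimension bookkeeping made explicit — for `θ ∈ ℂ^m` with
`trdeg_ℚ ℚ(θ) ≤ k + 1` (`k + 1 < m`) there is `C = C(θ, m, k) ≥ 1` such that, for `δ ≥ 1`,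
`τ ≥ 2mδ`, `σ ≥ 1`, `U > τ` and families as in (H) of `QuantitativeCIA.lean` at every real scale
`τ < Sσ^{k+1} ≤ U`, every `P ∈ ℤ[X₁, …, X_m]` with `P(θ) ≠ 0` and `deg P ≥ 1` satisfying
`C · K · (qδ)^k · (δ (deg P + log H(P)) + τ deg P) ≤ U` (`K = KConst m k σ θ`, `q = qConst m k σ`,
`H(P)` the naive height `mvPolyHeight`) has `|P(θ)| > e^{−U}` — the shape of (f):
`σ^{k+1} δ^k (δ h + τ D)`, with Ably's explicit `−nD log 2(n+1) − n² log|θ| − …` absorbed in `C`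
(which depends on `θ` through `deg 𝔭_ω̄`, `h(𝔭_ω̄)`). The hypothesis `P(θ) ≠ 0` is what the
Lindemann–Weierstrass theorem supplies in Ably's setting.

Also proved here, for that setting: adjoining algebraic numbers does not raise the transcendence
degree (`QuantCIA.trdeg_adjoin_append_le`: `trdeg_ℚ ℚ(y, w) ≤ n` for `y` algebraic and
`w ∈ ℂⁿ`), which gives `trdeg_ℚ ℚ(y, e^y) ≤ n` for the point of the Lindemann–Weierstrass theorem.
The real-arithmetic bookkeeping of the deduction is isolated in the lemmas `arith_*`.

## References

* [Ably1994] M. Ably, *Une version quantitative du théorème de Lindemann–Weierstrass*, Acta Arith.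
  67 (1994) 29–45, §I "Critère" and its proof, pp. 31–33.
* [NesterenkoPhilippon2001] Yu. V. Nesterenko, P. Philippon (eds.), LNM 1752 (2001), Ch. 3 §4
  Prop. 4.7, Cor. 4.10, Prop. 4.11, Prop. 4.13 (pp. 39–41), §5 (the ideal of a point, p. 42); Ch. 8
  (CIA) (PDF p. 162).
-/

noncomputable section

open MvPolynomial Real IntermediateField
open Literature.NumberTheory.Transcendental.Nesterenko
open Literature.NumberTheory.Transcendental.PhilipponMain

attribute [local instance] MvPolynomial.gradedAlgebra

namespace Literature.NumberTheory.Transcendental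

namespace QuantCIA

/-! ### Real-arithmetic bookkeeping -/

/-- `XP + m³ dJ ≤ (1 + hΘ + 11m² + m³) · dΘ (δ(D + Hh) + τ D)`. [folklore] -/
theorem arith_XP_le {m dΘ hΘ D Hh hE δ τ dJ : ℝ} (hm : 0 ≤ m) (hdΘ : 1 ≤ dΘ) (hhΘ : 0 ≤ hΘ)
    (hD : 0 ≤ D) (hHh : 0 ≤ Hh) (hhE : hE ≤ Hh) (hδ : 1 ≤ δ) (hτ : 0 ≤ τ) (hdJ : dJ ≤ dΘ * D) :
    hE * dΘ + hΘ * D + 11 * m ^ 2 * dΘ * D + m ^ 3 * dJ ≤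
      (1 + hΘ + 11 * m ^ 2 + m ^ 3) * (dΘ * (δ * (D + Hh) + τ * D)) := by
  have hdΘ0 : 0 ≤ dΘ := by linarith
  -- `Φ = dΘ (D + Hh) ≤ Ψ = dΘ (δ (D + Hh) + τ D)`
  have hΦΨ : dΘ * (D + Hh) ≤ dΘ * (δ * (D + Hh) + τ * D) := by
    apply mul_le_mul_of_nonneg_left _ hdΘ0
    have h1 : D + Hh ≤ δ * (D + Hh) := le_mul_of_one_le_left (by linarith) hδ
    have h2 : 0 ≤ τ * D := mul_nonneg hτ hD
    linarith
  have p1 : hE * dΘ ≤ Hh * dΘ := mul_le_mul_of_nonneg_right hhE hdΘ0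
  have p2 : hΘ * D ≤ hΘ * (dΘ * D) := by
    apply mul_le_mul_of_nonneg_left _ hhΘ
    calc D = 1 * D := (one_mul D).symm
      _ ≤ dΘ * D := mul_le_mul_of_nonneg_right hdΘ hD
  have p3 : m ^ 3 * dJ ≤ m ^ 3 * (dΘ * D) := mul_le_mul_of_nonneg_left hdJ (by positivity)
  have p4 : 0 ≤ hΘ * (dΘ * Hh) := by positivity
  have p5 : 0 ≤ m ^ 2 * (dΘ * Hh) := by positivity
  have p6 : 0 ≤ m ^ 3 * (dΘ * Hh) := by positivity
  have p7 := mul_le_mul_of_nonneg_left hΦΨ (by positivity : (0 : ℝ) ≤ 1 + hΘ + 11 * m ^ 2 + m ^ 3)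
  have p8 : 0 ≤ dΘ * D := by positivity
  linarith

/-- `T ≤ (1 + hΘ + m(k+3) + 2m²) · dΘ (δ(D + Hh) + τ D)`. [folklore] -/
theorem arith_T_le {m k dΘ hΘ D Hh δ τ r : ℝ} (hm : 0 ≤ m) (hr : 0 ≤ r) (hrk : r + 1 ≤ k + 3)
    (hdΘ : 1 ≤ dΘ) (hhΘ : 0 ≤ hΘ) (hD : 0 ≤ D) (hHh : 0 ≤ Hh) (hδ : 0 ≤ δ) (hτ : 0 ≤ τ) :
    δ * (hΘ * D + dΘ * Hh + (m * (r + 1) + 2 * m ^ 2) * dΘ * D) + τ * (dΘ * D) ≤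
      (1 + hΘ + m * (k + 3) + 2 * m ^ 2) * (dΘ * (δ * (D + Hh) + τ * D)) := by
  have hdΘ0 : 0 ≤ dΘ := by linarith
  have f1 : hΘ * D ≤ hΘ * (dΘ * D) := by
    apply mul_le_mul_of_nonneg_left _ hhΘ
    calc D = 1 * D := (one_mul D).symm
      _ ≤ dΘ * D := mul_le_mul_of_nonneg_right hdΘ hD
  have f2 : δ * (hΘ * D) ≤ δ * (hΘ * (dΘ * D)) := mul_le_mul_of_nonneg_left f1 hδ
  have f3 : m * (r + 1) ≤ m * (k + 3) := mul_le_mul_of_nonneg_left hrk hm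
  have f4 : m * (r + 1) * (δ * (dΘ * D)) ≤ m * (k + 3) * (δ * (dΘ * D)) :=
    mul_le_mul_of_nonneg_right f3 (by positivity)
  have hk3 : 0 ≤ m * (k + 3) := by nlinarith
  have n1 : 0 ≤ hΘ * (dΘ * (δ * Hh)) := by positivity
  have n2 : 0 ≤ hΘ * (dΘ * (τ * D)) := by positivity
  have n3 : 0 ≤ m * (k + 3) * (dΘ * (δ * Hh)) := mul_nonneg hk3 (by positivity)
  have n4 : 0 ≤ m * (k + 3) * (dΘ * (τ * D)) := mul_nonneg hk3 (by positivity)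
  have n5 : 0 ≤ m ^ 2 * (dΘ * (δ * Hh)) := by positivity
  have n6 : 0 ≤ m ^ 2 * (dΘ * (τ * D)) := by positivity
  have n7 : 0 ≤ dΘ * (δ * D) := by positivity
  linarith

/-- The budget: from `(c₁ + c₂) Kc qk Ψ ≤ U`, `XPJ ≤ c₁ Ψ`, `T ≤ c₂ Ψ`. [folklore] -/
theorem arith_budget_core {c₁ c₂ Kc qk Ψ U XPJ T : ℝ} (hc₁ : 0 ≤ c₁) (hc₂ : 1 ≤ c₂) (hKc : 2 ≤ Kc)
    (hqk : 1 ≤ qk) (hΨ : 0 < Ψ) (hXPJ : XPJ ≤ c₁ * Ψ) (hT : T ≤ c₂ * Ψ)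
    (hcond : (c₁ + c₂) * Kc * qk * Ψ ≤ U) :
    XPJ + Kc * qk * T ≤ U ∧ XPJ + Ψ ≤ U := by
  have hKq : 1 ≤ Kc * qk := one_le_mul_of_one_le_of_one_le (by linarith) hqk
  have hKq0 : 0 ≤ Kc * qk := by linarith
  have h1 : c₁ * Ψ ≤ c₁ * Ψ * (Kc * qk) := le_mul_of_one_le_right (by positivity) hKq
  have h2 : Kc * qk * T ≤ Kc * qk * (c₂ * Ψ) := mul_le_mul_of_nonneg_left hT hKq0
  have h4 : Ψ ≤ Ψ * (Kc * qk) := le_mul_of_one_le_right hΨ.le hKq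
  have h5 : Ψ * (Kc * qk) ≤ c₂ * Ψ * (Kc * qk) := by
    rw [mul_assoc c₂]
    exact le_mul_of_one_le_left (by positivity) hc₂
  have e : (c₁ + c₂) * Kc * qk * Ψ = c₁ * Ψ * (Kc * qk) + c₂ * Ψ * (Kc * qk) := by ring
  rw [e] at hcond
  constructor
  · linarith
  · linarith

/-- Sizes of `J` and of the component against `T`. [folklore] -/
theorem arith_sizes {m dΘ hΘ D Hh hE δ τ r dX hX : ℝ} (hdΘ : 0 ≤ dΘ) (hD : 0 ≤ D)
    (hhE : hE ≤ Hh) (hδ : 0 ≤ δ) (hτ : 0 ≤ τ) (hdX : dX ≤ dΘ * D)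
    (hhX : hX ≤ hΘ * D + hE * dΘ + (m * (r + 1) + m ^ 2) * dΘ * D) :
    δ * hX + τ * dX ≤
      δ * (hΘ * D + dΘ * Hh + (m * (r + 1) + 2 * m ^ 2) * dΘ * D) + τ * (dΘ * D) := by
  have h1 : hX ≤ hΘ * D + dΘ * Hh + (m * (r + 1) + 2 * m ^ 2) * dΘ * D := by
    have e1 : hE * dΘ ≤ dΘ * Hh := by rw [mul_comm]; exact mul_le_mul_of_nonneg_left hhE hdΘ
    have e2 : 0 ≤ m ^ 2 * (dΘ * D) := by positivity
    linarith
  have h2 := mul_le_mul_of_nonneg_left h1 hδ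
  have h3 := mul_le_mul_of_nonneg_left hdX hτ
  linarith

/-- The `J`-variant: `δ (hJ + m² dJ) + τ dJ ≤ T`. [folklore] -/
theorem arith_sizesJ {m dΘ hΘ D Hh hE δ τ r dJ hJ : ℝ} (hdΘ : 0 ≤ dΘ) (hD : 0 ≤ D)
    (hhE : hE ≤ Hh) (hδ : 0 ≤ δ) (hτ : 0 ≤ τ) (hdJ : dJ ≤ dΘ * D)
    (hhJ : hJ ≤ hΘ * D + hE * dΘ + m * (r + 1) * dΘ * D) :
    δ * (hJ + m ^ 2 * dJ) + τ * dJ ≤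
      δ * (hΘ * D + dΘ * Hh + (m * (r + 1) + 2 * m ^ 2) * dΘ * D) + τ * (dΘ * D) := by
  refine arith_sizes hdΘ hD hhE hδ hτ hdJ ?_
  have := mul_le_mul_of_nonneg_left hdJ (sq_nonneg m)
  linarith

/-- `T > 0`. [folklore] -/
theorem arith_T_pos {m dΘ hΘ D Hh δ τ r : ℝ} (hm : 0 ≤ m) (hr : 0 ≤ r) (hdΘ : 1 ≤ dΘ)
    (hhΘ : 0 ≤ hΘ) (hD : 1 ≤ D) (hHh : 0 ≤ Hh) (hδ : 0 ≤ δ) (hτ : 0 < τ) :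
    0 < δ * (hΘ * D + dΘ * Hh + (m * (r + 1) + 2 * m ^ 2) * dΘ * D) + τ * (dΘ * D) := by
  have hD0 : 0 ≤ D := by linarith
  have hdΘ0 : 0 ≤ dΘ := by linarith
  have h1 : 0 < τ * (dΘ * D) := by
    have : 0 < dΘ * D := by nlinarith
    positivity
  have h2 : 0 ≤ δ * (hΘ * D + dΘ * Hh + (m * (r + 1) + 2 * m ^ 2) * dΘ * D) := by positivity
  linarith


/-- The budget, assembled: Prop. 4.11's exponent `XP = h(E) dΘ + hΘ D + 11 m² dΘ D`, the loss
`m³ deg J` of Prop. 4.7 and `K (qδ)^k T` all fit into `U`. [folklore] -/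
theorem arith_budget {m k dΘ hΘ D Hh hE δ τ r dJ Kc qk U : ℝ} (hm : 0 ≤ m) (hr : 0 ≤ r)
    (hrk : r + 1 ≤ k + 3) (hdΘ : 1 ≤ dΘ) (hhΘ : 0 ≤ hΘ) (hD : 1 ≤ D) (hHh : 0 ≤ Hh)
    (hhE0 : 0 ≤ hE) (hhE : hE ≤ Hh) (hδ : 1 ≤ δ) (hτ : 0 < τ) (hKc : 2 ≤ Kc) (hqk : 1 ≤ qk)
    (hdJ0 : 0 ≤ dJ) (hdJ : dJ ≤ dΘ * D)
    (hcond : dΘ * (2 + 2 * hΘ + m * (k + 3) + 13 * m ^ 2 + m ^ 3) * Kc * qk *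
      (δ * (D + Hh) + τ * D) ≤ U) :
    hE * dΘ + hΘ * D + 11 * m ^ 2 * dΘ * D < U ∧
    m ^ 3 * dJ ≤ U - (hE * dΘ + hΘ * D + 11 * m ^ 2 * dΘ * D) ∧
    Kc * qk * (δ * (hΘ * D + dΘ * Hh + (m * (r + 1) + 2 * m ^ 2) * dΘ * D) + τ * (dΘ * D)) ≤
      U - (hE * dΘ + hΘ * D + 11 * m ^ 2 * dΘ * D) - m ^ 3 * dJ ∧
    U - (hE * dΘ + hΘ * D + 11 * m ^ 2 * dΘ * D) - m ^ 3 * dJ ≤ U := by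
  have hD0 : 0 ≤ D := by linarith
  have hδ0 : 0 ≤ δ := by linarith
  have hdΘ0 : 0 ≤ dΘ := by linarith
  have hXPJ := arith_XP_le hm hdΘ hhΘ hD0 hHh hhE hδ hτ.le hdJ
  have hTle := arith_T_le hm hr hrk hdΘ hhΘ hD0 hHh hδ0 hτ.le
  have hT0 := arith_T_pos hm hr hdΘ hhΘ hD hHh hδ0 hτ
  have hΨ : 0 < dΘ * (δ * (D + Hh) + τ * D) := by
    have h1 : 0 < τ * D := mul_pos hτ (by linarith)
    have h2 : 0 ≤ δ * (D + Hh) := by positivity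
    have h3 : 0 < dΘ := by linarith
    have h4 : 0 < δ * (D + Hh) + τ * D := by linarith
    positivity
  set Ψ := dΘ * (δ * (D + Hh) + τ * D) with hΨdef
  have hk3 : 0 ≤ m * (k + 3) := by nlinarith
  have hc₁ : (0 : ℝ) ≤ 1 + hΘ + 11 * m ^ 2 + m ^ 3 := by positivity
  have hc₂ : (1 : ℝ) ≤ 1 + hΘ + m * (k + 3) + 2 * m ^ 2 := by nlinarith [sq_nonneg m]
  have hcond' : ((1 + hΘ + 11 * m ^ 2 + m ^ 3) + (1 + hΘ + m * (k + 3) + 2 * m ^ 2)) * Kc * qk *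
      Ψ ≤ U := by
    calc ((1 + hΘ + 11 * m ^ 2 + m ^ 3) + (1 + hΘ + m * (k + 3) + 2 * m ^ 2)) * Kc * qk * Ψ
        = dΘ * (2 + 2 * hΘ + m * (k + 3) + 13 * m ^ 2 + m ^ 3) * Kc * qk *
            (δ * (D + Hh) + τ * D) := by rw [hΨdef]; ring
      _ ≤ U := hcond
  obtain ⟨h1, h2⟩ := arith_budget_core hc₁ hc₂ hKc hqk hΨ hXPJ hTle hcond'
  have hKq0 : 0 ≤ Kc * qk := by nlinarith
  have hKqT : 0 ≤ Kc * qk *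
      (δ * (hΘ * D + dΘ * Hh + (m * (r + 1) + 2 * m ^ 2) * dΘ * D) + τ * (dΘ * D)) :=
    mul_nonneg hKq0 hT0.le
  have hm3 : 0 ≤ m ^ 3 * dJ := by positivity
  have hXP0 : 0 ≤ hE * dΘ + hΘ * D + 11 * m ^ 2 * dΘ * D := by positivity
  refine ⟨by linarith, by linarith, by linarith, by linarith⟩

/-- The final comparison with `UQ = Kq sQ`. [folklore] -/
theorem arith_final {R T sQ Kq τ U : ℝ} (hT : 0 < T) (hKT : Kq * T ≤ R) (hRU : R ≤ U)
    (hsT : sQ ≤ T) (hτs : τ ≤ sQ) (hτ : 0 < τ) (hK2 : 2 ≤ Kq) :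
    exp (-(R / T) * sQ) ≤ exp (-(Kq * sQ)) ∧ Kq * sQ ≤ U ∧ τ < Kq * sQ := by
  have hs0 : 0 < sQ := lt_of_lt_of_le hτ hτs
  have hW : Kq ≤ R / T := by rwa [le_div_iff₀ hT]
  refine ⟨?_, ?_, ?_⟩
  · rw [exp_le_exp, neg_mul, neg_le_neg_iff]
    exact mul_le_mul_of_nonneg_right hW hs0.le
  · calc Kq * sQ ≤ Kq * T := mul_le_mul_of_nonneg_left hsT (by linarith)
      _ ≤ R := hKT
      _ ≤ U := hRU
  · calc τ < 2 * τ := by linarith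
      _ ≤ Kq * sQ := mul_le_mul hK2 hτs hτ.le (by linarith)

/-- From `x ≤ b e^{A}` and `b ≤ e^{−U}`: `x ≤ e^{−(U − A)}`. [folklore] -/
theorem le_exp_of_le_mul_exp {x b A U : ℝ} (h : x ≤ b * exp A) (hb : b ≤ exp (-U)) :
    x ≤ exp (-(U - A)) := by
  calc x ≤ b * exp A := h
    _ ≤ exp (-U) * exp A := mul_le_mul_of_nonneg_right hb (exp_pos _).le
    _ = exp (-(U - A)) := by rw [← exp_add]; ring_nf

/-- From `1 ≤ b e^{A}` and `b ≤ e^{−U}`: `U ≤ A`. [folklore] -/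
theorem le_of_one_le_mul_exp {b A U : ℝ} (h : 1 ≤ b * exp A) (hb : b ≤ exp (-U)) : U ≤ A := by
  have h1 : (1 : ℝ) ≤ exp (-(U - A)) := le_exp_of_le_mul_exp h hb
  have h2 : 0 ≤ -(U - A) := by
    by_contra hlt
    have : exp (-(U - A)) < 1 := exp_lt_one_iff.mpr (by linarith)
    linarith
  linarith


/-! ### Adjoining algebraic numbers does not raise the transcendence degree -/

/-- **`trdeg_F F(θ) ≤ #T` when the coordinates of `θ` outside `T` are algebraic over `F`.**
For `θ : ι → E` and a finite set `T ⊆ E` such that every `θ i ∉ T` is algebraic over `F`, the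
field `F(θ)` is algebraic over the `F`-algebra generated by (the preimage of) `T`, so
`trdeg_F F(θ) ≤ #T` (Mathlib's `Algebra.IsAlgebraic.trdeg_le_cardinalMk`). [folklore] -/
theorem trdeg_adjoin_range_le_card {F E : Type*} [Field F] [Field E] [Algebra F E] {ι : Type*}
    (θ : ι → E) (T : Finset E) (halg : ∀ i, θ i ∉ T → IsAlgebraic F (θ i)) :
    Algebra.trdeg F ↥(adjoin F (Set.range θ)) ≤ (T.card : Cardinal) := by
  classical
  set K := adjoin F (Set.range θ) with hK
  set s : Set K := ((↑) : K → E) ⁻¹' Set.range θ with hs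
  set t : Set K := ((↑) : K → E) ⁻¹' (T : Set E) with ht
  haveI halgs : Algebra.IsAlgebraic (Algebra.adjoin F s) K :=
    isAlgebraic_adjoin_over_algebraAdjoin (F := F) (Set.range θ)
  -- `K` is algebraic over `F[s]`, hence over `F[t]` (`s ∖ t` consists of algebraic elements)
  haveI : Algebra.IsAlgebraic (Algebra.adjoin F t) K := by
    refine ⟨fun a => ?_⟩
    have ha : IsAlgebraic (Algebra.adjoin F s) a := halgs.isAlgebraic a
    refine IsAlgebraic.adjoin_of_forall_isAlgebraic (fun x hx => ?_) ha
    obtain ⟨⟨i, hi⟩, hxT⟩ := hx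
    have hxalg : IsAlgebraic F (x : E) := by
      rw [← hi]; exact halg i (by rw [hi]; exact hxT)
    have hxK : IsAlgebraic F x := IntermediateField.isAlgebraic_iff.mpr hxalg
    exact hxK.extendScalars (R := F) (S := Algebra.adjoin F t)
      (FaithfulSMul.algebraMap_injective F (Algebra.adjoin F t))
  refine (Algebra.IsAlgebraic.trdeg_le_cardinalMk F t).trans ?_
  calc Cardinal.mk t ≤ Cardinal.mk (T : Set E) :=
        Cardinal.mk_preimage_of_injective _ _ Subtype.val_injective
    _ = T.card := Cardinal.mk_coe_finset

/-- **Adjoining algebraic numbers does not raise the transcendence degree**: if `y₁, …, y_a` are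
algebraic over `ℚ` then `trdeg_ℚ ℚ(y, w) ≤ n` for every `w ∈ ℂⁿ` (so the point `(y, e^y)` of the
Lindemann–Weierstrass theorem has `trdeg ≤ n`). [folklore] -/
theorem trdeg_adjoin_append_le {a n : ℕ} (y : Fin a → ℂ) (w : Fin n → ℂ)
    (halg : ∀ i, IsAlgebraic ℚ (y i)) :
    Algebra.trdeg ℚ ↥(adjoin ℚ (Set.range (Fin.append y w))) ≤ (n : Cardinal) := by
  classical
  set T : Finset ℂ := Finset.univ.image w with hT
  have h := trdeg_adjoin_range_le_card (F := ℚ) (Fin.append y w) T (fun i hi => ?_)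
  · refine h.trans ?_
    have : T.card ≤ n := by
      rw [hT]
      exact (Finset.card_image_le).trans (by simp)
    exact_mod_cast this
  · -- `Fin.append y w i ∉ T` forces `i` to be a left index
    refine Fin.addCases (fun j hj => ?_) (fun j hj => ?_) i hi
    · rw [Fin.append_left]; exact halg j
    · exfalso; apply hj
      rw [Fin.append_right, hT, Finset.mem_image]
      exact ⟨j, Finset.mem_univ _, rfl⟩

/-! ### Constants -/

/-- `K(m, k, σ, θ) ≥ 2`. [folklore] -/
theorem two_le_KConst (m k : ℕ) {σ : ℝ} (hσ : 1 ≤ σ) (θ : Fin m → ℂ) : 2 ≤ KConst m k σ θ := by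
  unfold KConst
  have hm0 : (0 : ℝ) ≤ m := Nat.cast_nonneg _
  have hk0 : (0 : ℝ) ≤ k := Nat.cast_nonneg _
  have hc0 : (0 : ℝ) ≤ ((⌈4 * σ⌉₊ : ℕ) : ℝ) := Nat.cast_nonneg _
  have hlog : 0 ≤ Real.log (4 * ‖(Fin.cons 1 θ : Fin (m + 1) → ℂ)‖ ^ 2) :=
    Real.log_nonneg (by nlinarith [one_le_norm_cons_one θ])
  have h1 : (0 : ℝ) ≤ 8 * (k + 1) * (m : ℝ) ^ 3 := by positivity
  have h2 : (0 : ℝ) ≤ 2 * ((⌈4 * σ⌉₊ : ℕ) : ℝ) * (1 + 12 * (m : ℝ) ^ 2) := by positivity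
  have h3 : (0 : ℝ) ≤ 4 * (m : ℝ) ^ 3 * ((⌈4 * σ⌉₊ : ℕ) : ℝ) := by positivity
  have h4 : (0 : ℝ) ≤
      2 * (k + 1) * (σ + 2 * Real.log (4 * ‖(Fin.cons 1 θ : Fin (m + 1) → ℂ)‖ ^ 2) + 3) := by
    have : (0 : ℝ) ≤ σ := by linarith
    positivity
  linarith

/-- `q(m, k, σ) δ ≥ 1` for `σ, δ ≥ 1`. [folklore] -/
theorem one_le_qConst_mul {m k : ℕ} {σ δ : ℝ} (hσ : 1 ≤ σ) (hδ : 1 ≤ δ) :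
    1 ≤ qConst m k σ * δ := by
  refine one_le_mul_of_one_le_of_one_le ?_ hδ
  unfold qConst
  have hc4 : (4 : ℝ) ≤ ((⌈4 * σ⌉₊ : ℕ) : ℝ) := by
    have : 4 * σ ≤ ((⌈4 * σ⌉₊ : ℕ) : ℝ) := Nat.le_ceil _
    linarith
  have hm0 : (0 : ℝ) ≤ m := Nat.cast_nonneg _
  have hk0 : (0 : ℝ) ≤ k := Nat.cast_nonneg _
  have h1 : (3 : ℝ) ≤ 3 + (m : ℝ) * (k + 3) + (m : ℝ) ^ 2 := by nlinarith [sq_nonneg (m : ℝ)]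
  nlinarith

/-! ### The cone ideal of the point -/

/-- `|𝔭_ω̄(ω̄)| = 0` for the cone ideal of `ω̄ = (1, θ)` (Cor. 4.10 with `ρ_ω̄(𝔭_ω̄) = 0`).
[cite: NesterenkoPhilippon2001, Ch. 3 Cor. 4.10 (p. 40) and §5 (p. 42)] -/
theorem iabs_coneIdeal_eq_zero {m r : ℕ} (hr1 : 1 ≤ r) (hrm : r ≤ m) (θ : Fin m → ℂ)
    (hunm : IsUnmixedOfRank (coneIdeal (Fin.cons 1 θ : Fin (m + 1) → ℂ)) r) :
    iabs (coneIdeal (Fin.cons 1 θ : Fin (m + 1) → ℂ)) r (Fin.cons 1 θ) = 0 := by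
  have hω := cons_one_ne_zero θ
  have h := NesterenkoPhilippon2001_ch3_cor_4_10_holds m r _ hr1 hrm (isPrime_coneIdeal _)
    (isHomogeneous_coneIdeal _) hunm (Fin.cons 1 θ) hω
  rw [rho_coneIdeal hω, zero_mul] at h
  exact le_antisymm h (iabs_nonneg _ _ _)

/-! ### Ably's Critère over `ℚ` -/

/-- **Ably's Critère over `ℚ` (the affine quantitative criterion), with the constant depending on
the point.** Let `k + 1 < m`, `θ ∈ ℂ^m` with `trdeg_ℚ ℚ(θ) ≤ k + 1`. There is `C ≥ 1` (depending
on `θ, m, k`) such that: for `δ ≥ 1`, `τ ≥ 2mδ`, `σ ≥ 1`, `U > τ`, families of homogeneous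
`E_j ∈ ℚ[x₀, …, x_m]` at every real scale `τ < Sσ^{k+1} ≤ U` as in hypothesis (H)
(`deg ≤ δ`, `h ≤ τ`, `‖E_j‖_ω̄ ≤ exp(−Sσ^{k+1})`, no common zero `(1 : z)` with
`max|z_i − θ_i| < exp(−Sσ^{k+2})`), and every `P ∈ ℤ[X₁, …, X_m]` with `P(θ) ≠ 0`, `deg P ≥ 1` and
`C · KConst m k σ θ · (qConst m k σ · δ)^k · (δ (deg P + log H(P)) + τ deg P) ≤ U`, one has
`|P(θ)| > e^{−U}`. [cite: Ably1994, §I Critère (p. 31) and its proof (pp. 31–33)]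
[cite: NesterenkoPhilippon2001, Ch. 8 (CIA) (PDF p. 162); Ch. 3 Prop. 4.11, Prop. 4.7 (pp. 39–41)] -/
theorem exists_const_polynomial_measure {m k : ℕ} (hkm : k + 1 < m) (θ : Fin m → ℂ)
    (htr : Algebra.trdeg ℚ ↥(adjoin ℚ (Set.range θ)) ≤ (k + 1 : ℕ)) :
    ∃ C : ℝ, 1 ≤ C ∧ ∀ (δ τ σ U : ℝ), 1 ≤ δ → 2 * m * δ ≤ τ → 1 ≤ σ → τ < U →
      (∀ S : ℝ, τ < S * σ ^ (k + 1) → S * σ ^ (k + 1) ≤ U →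
        ∃ (M : ℕ) (E : Fin M → Rx m) (d : Fin M → ℕ),
          (∀ j, (E j).IsHomogeneous (d j)) ∧ (∀ j, (d j : ℝ) ≤ δ) ∧ (∀ j, height (E j) ≤ τ) ∧
          (∀ j, normAt (Fin.cons 1 θ : Fin (m + 1) → ℂ) (E j) ≤ exp (-(S * σ ^ (k + 1)))) ∧
          ∀ z : Fin m → ℂ, (∀ i, ‖z i - θ i‖ < exp (-(S * σ ^ (k + 2)))) →
            ∃ j, aeval (Fin.cons 1 z : Fin (m + 1) → ℂ) (E j) ≠ 0) →
      ∀ P : MvPolynomial (Fin m) ℤ, aeval θ P ≠ 0 → 1 ≤ P.totalDegree →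
        C * KConst m k σ θ * (qConst m k σ * δ) ^ k *
            (δ * (P.totalDegree + Real.log (mvPolyHeight P)) + τ * P.totalDegree) ≤ U →
        exp (-U) < ‖aeval θ P‖ := by
  classical
  -- the cone ideal `𝔭` of `ω̄ = (1, θ)`: a homogeneous prime of rank `r₀ ≤ k + 2` with `|𝔭(ω̄)| = 0`
  obtain ⟨r₀, hr₀1, hr₀k, hunm⟩ := exists_isUnmixedOfRank_coneIdeal θ htr
  have hr₀m : r₀ ≤ m := by omega
  have hiabs := iabs_coneIdeal_eq_zero hr₀1 hr₀m θ hunm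
  set ω : Fin (m + 1) → ℂ := Fin.cons 1 θ with hωdef
  have hω0 : ω ≠ 0 := cons_one_ne_zero θ
  set 𝔭 : Ideal (Rx m) := coneIdeal ω with h𝔭def
  have h𝔭p : 𝔭.IsPrime := isPrime_coneIdeal ω
  have h𝔭h : 𝔭.IsHomogeneous (homogeneousSubmodule (Fin (m + 1)) ℚ) := isHomogeneous_coneIdeal ω
  -- `dΘ = deg 𝔭 ≥ 1`, `hΘ = h(𝔭) ≥ 0`
  set dΘ : ℝ := (ideg 𝔭 r₀ : ℝ) with hdΘ
  set hΘ : ℝ := iheight 𝔭 r₀ with hhΘ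
  have hdΘ1 : 1 ≤ dΘ := by
    rw [hdΘ]
    exact_mod_cast Literature.Barriers.Schanuel.one_le_ideg_of_isPrime
      NesterenkoPhilippon2001_ch3_prop_4_4_holds hr₀1 hr₀m h𝔭p h𝔭h hunm
  have hdΘ0 : 0 ≤ dΘ := by linarith
  have hhΘ0 : 0 ≤ hΘ := height_nonneg _
  have hm0 : (0 : ℝ) ≤ m := Nat.cast_nonneg _
  have hk0 : (0 : ℝ) ≤ k := Nat.cast_nonneg _
  have hr₀0 : (0 : ℝ) ≤ r₀ := Nat.cast_nonneg _
  have hr₀k' : (r₀ : ℝ) + 1 ≤ k + 3 := by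
    have : (r₀ : ℝ) ≤ ((k + 1 : ℕ) : ℝ) + 1 := by exact_mod_cast hr₀k
    push_cast at this
    linarith
  -- the constant
  refine ⟨dΘ * (2 + 2 * hΘ + (m : ℝ) * (k + 3) + 13 * (m : ℝ) ^ 2 + (m : ℝ) ^ 3), ?_, ?_⟩
  · have h2 : (2 : ℝ) ≤ 2 + 2 * hΘ + (m : ℝ) * (k + 3) + 13 * (m : ℝ) ^ 2 + (m : ℝ) ^ 3 := by
      have : (0 : ℝ) ≤ (m : ℝ) * (k + 3) := by positivity
      have : (0 : ℝ) ≤ 13 * (m : ℝ) ^ 2 + (m : ℝ) ^ 3 := by positivity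
      linarith
    nlinarith
  intro δ τ σ U hδ hτ hσ hU hfam P hPθ hPdeg hcond
  -- sizes of `P`
  have hP0 : P ≠ 0 := fun h => hPθ (by rw [h, map_zero])
  have hH1 : (1 : ℝ) ≤ mvPolyHeight P := by exact_mod_cast one_le_mvPolyHeight hP0
  have hHh0 : 0 ≤ Real.log (mvPolyHeight P) := Real.log_nonneg hH1
  have hD1 : (1 : ℝ) ≤ P.totalDegree := by exact_mod_cast hPdeg
  have hD0 : (0 : ℝ) ≤ P.totalDegree := by linarith
  have hδ0 : 0 ≤ δ := by linarith
  have hm1 : (1 : ℝ) ≤ m := by exact_mod_cast (show 1 ≤ m by omega)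
  have hτ0 : 0 < τ := by nlinarith
  -- the constants of the criterion
  have hK2 : 2 ≤ KConst m k σ θ := two_le_KConst m k hσ θ
  have hqk : 1 ≤ (qConst m k σ * δ) ^ k := one_le_pow₀ (one_le_qConst_mul hσ hδ)
  -- the homogenisation `E = ʰP ∉ 𝔭`
  obtain ⟨E, hEhom, hEval, hEmax, hEh, -⟩ := PhilipponMain.exists_homogenization P
  have hEmem : E ∉ 𝔭 := fun h =>
    hPθ ((mem_coneIdeal_iff_of_homogenization hEhom hEval θ).mp h)
  have hhE0 : 0 ≤ height E := height_nonneg _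
  -- suppose, for contradiction, that `|P(θ)| ≤ e^{−U}`; then Prop. 4.11's `δ ≤ e^{−U}`
  by_contra hnot
  have hnorm : normAt ω E ≤ exp (-U) :=
    (normAt_le_of_homogenization hP0 hEval hEmax θ).trans (not_lt.mp hnot)
  have hδB : bezoutDelta 𝔭 r₀ E ω ≤ exp (-U) := by
    refine (bezoutDelta_le_max 𝔭 r₀ E ω).trans (max_le hnorm ?_)
    rw [hiabs]
    exact (exp_pos _).le
  have h411 := NesterenkoPhilippon2001_ch3_prop_4_11_holds m r₀ 𝔭 E P.totalDegree hr₀1 hr₀m h𝔭p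
    h𝔭h hunm hEhom hPdeg hEmem
  rcases (show r₀ = 1 ∨ 2 ≤ r₀ by omega) with hr | hr₀2
  · -- `r₀ = 1`: Proposition 4.11 leaves no room at all
    have h1 := h411.2 hr ω hω0
    have hUXP := le_of_one_le_mul_exp h1 hδB
    rw [← hdΘ, ← hhΘ] at hUXP
    obtain ⟨hlt, -, -, -⟩ := arith_budget hm0 hr₀0 hr₀k' hdΘ1 hhΘ0 hD1 hHh0 hhE0 hEh hδ hτ0 hK2
      hqk le_rfl (by positivity : (0 : ℝ) ≤ dΘ * P.totalDegree) hcond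
    exact absurd hUXP (not_le.mpr hlt)
  -- `r₀ ≥ 2`: cut `𝔭` by `E` (Prop. 4.11) …
  obtain ⟨J, hJhom, hJunm, hJV, hJdeg, hJh, hJsmall⟩ := h411.1 hr₀2
  have hJdegR : (ideg J (r₀ - 1) : ℝ) ≤ dΘ * P.totalDegree := by
    rw [hdΘ]
    exact_mod_cast hJdeg
  rw [← hdΘ, ← hhΘ] at hJh
  have hJle := le_exp_of_le_mul_exp (hJsmall ω hω0) hδB
  rw [← hdΘ, ← hhΘ] at hJle
  -- … the budget …
  obtain ⟨-, hUX, hKT, hRU⟩ := arith_budget hm0 hr₀0 hr₀k' hdΘ1 hhΘ0 hD1 hHh0 hhE0 hEh hδ hτ0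
    hK2 hqk (Nat.cast_nonneg _) hJdegR hcond
  have hT0 := arith_T_pos hm0 hr₀0 hdΘ1 hhΘ0 hD1 hHh0 hδ0 hτ0
  have hTle := arith_sizesJ hdΘ0 hD0 hEh hδ0 hτ0.le hJdegR hJh
  -- … a small prime component `𝔔 = √Q` of the cut (Prop. 4.7 and the pigeonhole) …
  obtain ⟨t, ht⟩ : ∃ t : Finset (Ideal (Rx m)), Submodule.IsMinimalPrimaryDecomposition J t :=
    Submodule.IsLasker.exists_isMinimalPrimaryDecomposition (Submodule.isLasker _ _) J
  have hr1' : 1 ≤ r₀ - 1 := by omega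
  have hrm' : r₀ - 1 ≤ m := by omega
  obtain ⟨Q, hQ, hQsmall⟩ := exists_component_le_exp NesterenkoPhilippon2001_ch3_prop_4_7_holds
    hr1' hrm' hJhom hJunm ht hω0 hδ0 hT0 hTle hUX hJle
  obtain ⟨hqprime, hqhom, hqunm, -, -⟩ :=
    Literature.Barriers.Schanuel.radical_component_facts hJhom hJunm ht hQ
  have hne : (projZeros Q.radical).Nonempty := by
    obtain ⟨β, hβ, -⟩ := NesterenkoPhilippon2001_ch3_prop_4_13_holds m (r₀ - 1) Q.radical hr1'
      hrm' hqhom hqunm ω hω0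
    exact ⟨β, hβ⟩
  obtain ⟨-, -, hqdeg, hqh⟩ := cut_component_facts NesterenkoPhilippon2001_ch3_prop_4_7_holds
    NesterenkoPhilippon2001_ch3_prop_4_11_holds hr₀2 hr₀m h𝔭p h𝔭h hunm hEhom hEmem hJhom hJunm hJV
    ht hQ hne
  rw [← hdΘ, ← hhΘ] at hqh
  have hdegQ1 : 1 ≤ ideg Q.radical (r₀ - 1) :=
    Literature.Barriers.Schanuel.one_le_ideg_of_isPrime NesterenkoPhilippon2001_ch3_prop_4_4_holds
      hr1' hrm' hqprime hqhom hqunm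
  have hqdegR : (ideg Q.radical (r₀ - 1) : ℝ) ≤ dΘ * P.totalDegree := by
    rw [hdΘ]
    exact_mod_cast hqdeg
  -- … whose size `δ h(𝔔) + τ deg 𝔔` is at most `T` and at least `τ`
  have hsQT := arith_sizes hdΘ0 hD0 hEh hδ0 hτ0.le hqdegR hqh
  have hsQτ : τ ≤ δ * iheight Q.radical (r₀ - 1) + τ * ideg Q.radical (r₀ - 1) := by
    have h1 : τ * 1 ≤ τ * (ideg Q.radical (r₀ - 1) : ℝ) :=
      mul_le_mul_of_nonneg_left (by exact_mod_cast hdegQ1) hτ0.le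
    have h2 : 0 ≤ δ * iheight Q.radical (r₀ - 1) := mul_nonneg hδ0 (height_nonneg _)
    linarith
  -- the criterion for `𝔔` with `U_𝔔 = K (qδ)^k (δ h(𝔔) + τ deg 𝔔)`
  have hKq2 : 2 ≤ KConst m k σ θ * (qConst m k σ * δ) ^ k :=
    le_trans (by linarith) (mul_le_mul hK2 hqk zero_le_one (by linarith))
  obtain ⟨hexp, hUQU, hτUQ⟩ := arith_final hT0 hKT hRU hsQT hsQτ hτ0 hKq2
  have hcondQ : KConst m k σ θ * ((δ * iheight Q.radical (r₀ - 1) +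
      τ * (max (ideg Q.radical (r₀ - 1)) 1 : ℕ)) * (qConst m k σ * δ) ^ k) ≤
      KConst m k σ θ * (qConst m k σ * δ) ^ k *
        (δ * iheight Q.radical (r₀ - 1) + τ * ideg Q.radical (r₀ - 1)) := by
    rw [max_eq_left hdegQ1]
    exact le_of_eq (by ring)
  have hlow := quantitativeCIA (show k < m by omega) θ hδ hτ hσ hτUQ
    (fun S h1 h2 => hfam S h1 (h2.trans hUQU)) Q.radical (r₀ - 1) hqprime hqhom hr1' (by omega)
    hqunm hcondQ
  exact absurd (hQsmall.trans hexp) (not_le.mpr hlow)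

end QuantCIA

end Literature.NumberTheory.Transcendental

end
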